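import Summits.HodgeConjecture.HodgeConjecture.Theorems.F0P6aRGDAssemblyDefs   -- ★ H1 (LAST part, LA7-plan (g7) v2 P3 8928e869): `RGDInputsAt`, `HeckeRoofsΩ`, `DockPackage`, `dockPackage_of_line`, `blockDock_of_inputs` (namespace `…F0P6aRGDAssembly` KEPT)
import Literature.NumberTheory.Automorphic.Liu2021.AppendixC.RecordHeckeReferencePresentation   -- ED. 3 «L1 fold»: ★ p847697 `exists_normal_referencePresentation` (organ `L1Fold.stub_REF`; ex leaf import l.2)
import Literature.AlgebraicGeometry.ShimuraVarieties.UnitaryShimuraCurveHeckePresentationLift   -- ED. 3 «L1 fold»: ★ p847810 `RecordSystemGS.hecke_of_hecke_at_chosen_lifts` (organ `L1Fold.stub_OLIFT`; ex leaf import l.3)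
import Literature.NumberTheory.Automorphic.UnitaryGroupHeckeCentralElement                       -- ED. 3 «L1 fold»: ★ `UnitaryGroup.coe_eq_of_mem_orbit_heckeElementAt_self` (organ `L1Fold.stub_PACK`; ex leaf import l.4)
import HarnessLib

/-!
# `F0P6aDatumOfInputsDefsDock` — ★ RE-HOME of the DEFS SIDE of `Lines/F0_P6a_DatumOfInputs.lean` (D-LINE hub ED. 3 sha16 a42642215a80d44d), PART 1 of 4 (size-lint split; cut at declaration boundaries).

HONEST LABEL: HC_CM is proved only modulo the 7 printed citations (2 remaining named inputs hLiu418 = stmt-HodgeConjecture-24832, h413 = stmt-HodgeConjecture-24833) until rung 0 closes; a re-home is count-neutral.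

K5-H2 (LEAD F0P6-plan (g5) «M-140» (1) + «M-140a» (1), desk F0P6c-plan (g8) pen, shape (H1b′) of LA2-p01 (g5)): the ★ twin of the D-LINE hub = its tree bytes MINUS exactly the two
`sorry` sockets and the socket-reading heads {`stub_DOWN` :796 (`sorry` :817), `stub_FROB` :835 (`sorry` :870), `datum_of_line` :884, `datum_of_inputs` :966, junction `example` :1013},
PLUS (§3★, LAST part) the socket TYPES `StubDOWNType`∕`StubFROBType`∕`DatumOfLineType` as closed `Prop`s and the ★-shaped head `datum_of_inputs_star` over them — cut into four parts:
PART 1 (this file) = §0 frame letters + `section Dock` (`DockData`, `DockPackage.nonempty_dockData`) + §0a–§0b letters `DockAt`, `nonempty_dockAt`, `LineOf`, `SubOf`, `kerFOf`,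
`IsEtaleOf`, `HeckeClause`, `RoofLink`, `RoofLink₂` (ED. 3 ll. 80–309); PART 2 `F0P6aDatumOfInputsDefsLetters` = `SpecReadings` … `frobOf` (ll. 310–483); PART 3 `F0P6aDatumOfInputsDefsOrgans`
= §0e `namespace L1Fold` organs `stub_REF`, `stub_OLIFT`, `stub_PACK` and head `stub_LINES_of_organs` (ll. 485–748); PART 4 `F0P6aDatumOfInputsDefs` (LAST; the module the hub ED. 4 and the
K6 twins import) = §1★ the PAID socket `stub_LINES` (BY TERM over §0e, ll. 752–783 with its `section Stubs` frame) + §3★.  Namespace `Summit.HodgeConjecture.HodgeConjecture.Cruxes.HLiu418.F0P6aDatumOfInputs`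
and every section KEPT (re-opened in each part exactly as they stand at the cut, `variable` lines replayed) ⇒ every FQN unchanged, 0 downstream bytes.  Imports = the hub՚s, with
`Lines.F0_P6a_RGDAssembly` → its ★ twin (line 1).  All declarations sorry-free; `--axioms` = {propext, Classical.choice, Quot.sound}.  No instance ∕ notation ∕ private; budgets ≤ 400 000 scoped `in`.

THE HUB՚S ED. 3 MODULE DOCSTRING (verbatim, for the record — its line numbers refer to ED. 3):

> # F0 · P6a — THE D-LINE `stub_DATUM := datum_of_line`: the moduli datum from the localised PEL inputs, FIELD GROUP BY FIELD GROUP (ED. 1 cand v3, P6c (g4))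
>
> `crux_decl: Summit.HodgeConjecture.HodgeConjecture.Theses.HCCMUnconditional.HLiu418`.  Sub-line of P6a under the spine
> `Lines/F0_P6a_RGDAssembly.lean` ED. 2 (tree 61a434989f165c71, A-p18 (g31), (FD) BUILT 2026-09-01T23:47:35Z), LEAD F0P6-plan (g3) «M-36-pre» (8) 23:22:32Z +
> «M-39» 23:29:14Z (closing topology: this line IMPORTS the spine and is a LEAF; main ED. 7 sets `stub_RGD := rgd_of_… pel_of_line datum_of_line` one level up) +
> GEN heir A-p18 (g31) fork rulings 23:30:03Z (F1 (a) ADM, F2 (b) `DockData` light shape, F3 SP4, F4, Q4 carriers = D-line §0).  HC_CM is proved only modulo the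
> printed citations until rung 0 closes; this file is count-neutral until its stubs close.
>
> HEAD `datum_of_line` has the type of the spine socket `stub_DATUM` (:333) TOKEN FOR TOKEN (`∀ F … θ _hθ e _hunit _hKc _hdisj, RGDInputsAt … → Nonempty (ModuliDatum …)`;
> junction certified by import: `example : type_of% @F0P6aRGDAssembly.stub_DATUM := @datum_of_line`) and is SORRY-FREE over the three named stubs below;
> `--axioms datum_of_line` = {propext, Classical.choice, Quot.sound, sorryAx} through exactly `stub_LINES`, `stub_DOWN`, `stub_FROB`.
>
> THE CUT (memo `F0/P6/F0P6c-plan/g4/MEMO-DLINE-cut.v1.F0P6c-plan-g4.md` 04deaeb71e1797a8, rows G1–G13):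
> * §0 THE DOCK AS DATA (G6, sorry-free; GEN heir (g31) Q2 shape): `DockData k p f A act w` = the 13 data ∕ 11 laws of spine §4 `DockPackage` over P6d՚s light variables
>   (field names = the `BlockReading₀` K-rows), `DockPackage.nonempty_dockData`, the point reading `DockAt I x̄` and `nonempty_dockAt` = spine §4 `blockDock_of_inputs` (fork F2 (b)).
> * §0 CARRIERS BY CONSTRUCTION (G5, fork F1 (a) ADM): `LineOf I y` = the admissible (`𝒪_F`-stable, order `q`, killed by `𝔭_{c•w}`) subgroups of `A_y(Ω)` on the sheet
>   `e` — EXACTLY the codomain of the (L4) bijection `β ↦ H_β`; `SubOf I 𝔡 x̄ := AdmSub (G₀ x̄) (β₀ x̄) q` (★ P6c §1), `kerFOf := ⟨kerFI …, isAdm_kerFI …⟩`, `IsEtaleOf := IdealIsEtale`;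
>   hence `subEquiv := Equiv.refl`, `kerF_spec := rfl`, `isEtale_spec := Iff.rfl` in the head.
> * §0 LETTERS: `HeckeClause` (the `hecke` field type verbatim over `LineOf I`), `RoofLink`∕`RoofLink₂` (the (L4) roofs as properties of the readings `quotΩ`∕`translΩ`),
>   the downstairs interface `SpecReadings` (light rows `sp quot transl red_quotΩ red_translΩ canonicalLine₀ smap smap_kerF quot_smap`) + the named laws `IsogHomLaw`,
>   `IsogKerLaw`, `QuotQuot₀Law` (D6 kills-form), `Quot₀RoofLaw` ((R-2)) + `DownReadings` (= `SpecReadings` + layer maps `isogW₀` + the four laws) — ONE interface at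
>   ED. 1 because the DEFINITIONS of `sp`∕`quot`∕`smap` need the schematic-closure vocabulary over `𝒪_Ω̄` (A-p03 (g30) organ (S-c); GEN Q4: typed HERE in §0 at ED. 2), and a
>   downstream stub taking `sp`∕`quot`∕`isogW₀` as FREE binders would be false as stated (perverse law-abiding readings break (b4′)∕D6∕the roof); ED. 2 re-cuts `stub_DOWN` into
>   `stub_SPEC`∕`stub_TWIST`∕`stub_LAYER`∕`stub_D6`∕`stub_ROOF` over those definitions (memo §3: 6 stubs).  Each law is its own `Prop` so no declaration elaborates the
>   dock tower twice (a flat `DownReadings` with the `isogW₀_ker` row inline exceeds 400 000 heartbeats at `whnf` — measured, bisection `isogW₀_hom` ✓ ∕ `isogW₀_ker` ✗).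
> * §0d PACKAGERS (sorry-free): `blockOf I 𝔡 𝔯 : BlockReading₀ …` (the 24 K-rows field-to-field from `𝔡`, `subEquiv := Equiv.refl`, `kerF_spec := rfl`, `isEtale_spec := Iff.rfl`,
>   layer rows ∕ (b4′) from `𝔯`) and `frobOf … : FrobReading₀ …`, each in its own budget; the head is `intro …; obtain` ×3 `; exact ⟨{33 fields}⟩`.
> * `stub_LINES` (G7; M): the generic readings `quotΩ`∕`translΩ` with `HeckeClause ∧ RoofLink ∧ RoofLink₂` — from (L4) `I.heckeRoofΩ` + ★ P6c §6 apparatus + (L1) `I.injΩ`.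
> * `stub_DOWN` (G8 ∕ G10 ∕ G11; L): `Nonempty (DownReadings …)` given the roof-linked generic readings and the frame guards `hunit hKc hdisj` (ROAD H: ★ HBT
>   `exists_line_quotΩ_quotΩ_eq_translΩ_of_hecke_of_hyperspecial` feeds its D6 clause; `inj₀` is consumed here, SP4); reads NO twist datum.
> * `stub_FROB` (G9 ∕ G12-twist ∕ (R-2); L; A-p03 (g30) pen, closer skeleton `StubFROB.closer.skeleton.v1.A-p03g30.lean` 7dd799c5): `∃ twistIdeal twistNorm frobIdeal`, the
>   `FrobReading₀` rows `frobIdeal_spec twistNorm_eq frob₀_cover quot₀_roof` + the guards `twistIdeal_coprime twistIdeal_ne_bot` — TWIST DATA EXISTENTIAL (v2): «`∀ I, I.twistNorm γ = q`»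
>   is FALSE IN TRUTH (rescaling junk `𝔞_γ ↦ (1+N)𝔞_γ`, `n_γ ↦ (1+N)²n_γ` preserves every `RGDInputsAt` ED. 2 law), so the pins `n_γ = q`∕`𝔭_w ∣ 𝔞_γ` must come through the interface
>   (A-p03 Q-FROB-1: spine ED. 3 laws `twistIdeal_frob`∕`twistNorm_frob`) before `twistIdeal := I.twistIdeal` can be read; until then the honest statement is existential.
> No instance ∕ notation ∕ private; budgets ≤ 400 000 scoped `in`; imports = the spine + HarnessLib.
> [cite: Liu2021, Prop. D.8 p. 135, pp. 136–138] [cite: HarrisTaylorAMS2001, §III.4, pp. 108–110] [cite: RapoportSmithlingZhang2020Diagonal, §4.1 p. 17; §4.3 (4.23) p. 21]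
> [cite: Tate1997FiniteFlatGroupSchemes, (3.7)] [cite: Shimura1998, §13.1 Thm. 1 (pp. 97–99)] [cite: Kottwitz1992, §5, pp. 390–391]
>
> ED. 3 «L1 FOLD» v2ns (cand, LA1-plan (g5) on LEAD «M-91» PLATE (a) — K3 planning input; D-LINE pen F0P6c-plan rules; = LA1-plan (g4) cand 2e732dbca03c2642 with ONE change:
> the folded organs live in the FRESH namespace `L1Fold`, not `StubLINES`): the L1 closer leaf `Lines/F0_P6a_StubLINES.lean` ED. 1 (a2cea14b7c1cc2df) body — organs
> `stub_REF` ∕ `stub_OLIFT` ∕ `stub_PACK` (all ★-paid, sorry-free) and head `stub_LINES_of_organs` — is pasted VERBATIM (leaf ll. 58–316) as §0e below under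
> `namespace L1Fold`, BEFORE `section Stubs`; the socket `stub_LINES` (statement TOKEN FOR TOKEN unchanged) is PAID IN-FILE `:= L1Fold.stub_LINES_of_organs I`, so this
> file's code-`sorry` count reads 2 {`stub_DOWN`, `stub_FROB`} and `--axioms stub_LINES` = TRIO.  FRESH NAMESPACE ⇒ NO FQN MOVES: the leaf ED. 1 (which declares
> `F0P6aDatumOfInputs.StubLINES.*` and imports this file) RE-MAKES UNCHANGED against this edition (no duplicate declarations), MAIN ED. 9՚s token
> `StubLINES.stub_LINES_of_organs` and its `import …Lines.F0_P6a_StubLINES` stay valid byte-for-byte, and NO leaf∕MAIN edition is needed in the same write block (the leaf may be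
> shimmed with an alias `StubLINES.stub_LINES_of_organs := L1Fold.stub_LINES_of_organs`, or MAIN re-pointed to the paid socket, in ANY LATER edition once this one is served).
> Imports = the spine + the leaf՚s three ★ modules + HarnessLib.
-/

set_option autoImplicit false

noncomputable section

namespace Summit.HodgeConjecture.HodgeConjecture.Cruxes.HLiu418.F0P6aDatumOfInputs

set_option linter.dupNamespace false  -- `Summit.HodgeConjecture.HodgeConjecture.…` BY DESIGN (D-0017)

open CategoryTheory CategoryTheory.Limits NumberField IsDedekindDomain MulAction
open scoped Matrix Polynomial Pointwise MonoidalCategory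
open Literature.NumberTheory.GaloisRepresentations
open Literature.NumberTheory.Automorphic Literature.NumberTheory.Automorphic.UnitaryGroup
open Literature.AlgebraicGeometry.ShimuraVarieties.UnitaryCanonicalModel
open Literature.NumberTheory.Automorphic.Liu2021.AppendixC
open Literature.AlgebraicGeometry.Motives (AlgPoints IntegralModel SchemeOver thickening thickeningGalAction thickeningLift specOver relFrobeniusOver frobeniusTwistOver)
open Literature.NumberTheory.DiophantineGeometry (geomResidueField specialFibreFunctor specResidueField)
open Literature.AlgebraicGeometry.RelativeSpec (ActionOver)
open Literature.NumberTheory.EllipticCurves (genericFibre)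
open Literature.AlgebraicGeometry.GroupSchemes.AffineGroupScheme (Alg quotIncl)
open Summit.HodgeConjecture.HodgeConjecture.Cruxes.HLiu418.F0P6cDictConstructors (kerFI AdmSub IdealIsEtale isAdm_kerFI)
open Summit.HodgeConjecture.HodgeConjecture.Cruxes.HLiu418.F0P6aModuliDatumDefs
open Summit.HodgeConjecture.HodgeConjecture.Cruxes.HLiu418.F0P6aRGDAssembly

section Letters

variable {F : Type} [Field F] [NumberField F] [IsCMField F] {ι₁ : F →+* ℂ}
    {Jstar : Matrix (Fin 2) (Fin 2) F}
    {K₀ : C5.OpenCompactSubgroup ↥(finAdelic ↥(maximalRealSubfield F) F (IsCMField.complexConj F) 2 Jstar)}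
    {S : RecordSystemGS F Jstar ι₁ K₀} {hU7ₛ : S.HeckeTranslateDefinedOver}
    {hJ : (Jstar.map (IsCMField.complexConj F))ᵀ = Jstar} {hJu : IsUnit Jstar}
    {Fi : Type} [Field Fi] [Algebra F Fi] {Kc : C5.SmallLevel K₀} {G : Type} [Group G]
    {𝓜 : IntegralModel (𝓞 F) F ((thickening F Fi).obj (S.M.obj Kc))}
    {w : HeightOneSpectrum (𝓞 F)} {hw : (IsCMField.complexConj F) • w ≠ w} {h𝓨 : (𝓜.localise w).IsSmoothProper 1}
    {θ : ActionOver (𝓜.localise w).total.hom ((Fi ≃ₐ[F] Fi) × G)}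
    {e : Fi →ₐ[F] AlgebraicClosure (w.adicCompletion F)}

/-! ### §0a THE DOCK AS DATA (G6, GEN heir (g31) 23:30:03Z Q2 shape): `DockData k p f A act w` over P6d՚s light variables, `DockPackage.nonempty_dockData`,
and its reading `DockAt I x̄` at a special point (sorry-free over spine §4 `blockDock_of_inputs`) -/

end Letters

section Dock

open AlgebraicGeometry MonoidalCategory CartesianMonoidalCategory Polynomial
open scoped MonObj Obj
open Literature.AlgebraicGeometry.GroupSchemes
open Literature.AlgebraicGeometry.GroupSchemes.GroupSchemeKernel (ker kerι)
open Literature.AlgebraicGeometry.AbelianSchemes Literature.AlgebraicGeometry.AbelianSchemes.AbelianSchemeOver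
open Literature.AlgebraicGeometry.AbelianSchemes.AbelianSchemeOver.RingAction

universe u v

-- as spine §4 `DockPackage` (:408): the scoped `GrpObj` on the DOUBLE Frobenius twist in `hFFU₀` does not synthesise at the default 20 000.
set_option synthInstance.maxHeartbeats 100000 in
/-- **`DockData k p f A act w`** — THE K∕BT DOCK PACKAGE AS DATA: the 13 data `G₀ grp₀ comm₀ aff₀ fin₀ ι₀G β₀ U₀ grpU₀ affU₀ jU₀ NU₀ θU₀` and the 11 laws
`hι₀G hkerG₀ hβ₀G hβ₀ hU₀ hNU₀ hFFU₀ hrkG₀ hrkF₀ hpts₀ hsimple₀` of spine §4 `DockPackage k p f A act w` (= the conclusion of ★ P6d `blockDocking_of_line`, ED. 7), TOKEN FOR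
TOKEN, over the SAME light variables (GEN heir A-p18 (g31) 2026-09-01T23:30:03Z Q2: field names = the Defs `BlockReading₀` K-rows so that G6 is field-to-field; P6d may
re-home it next to `DockPackage` at their ED. 8 (β), names kept).  A `Type`-valued record; NOTHING is asserted by declaring it.
[cite: Tate1997FiniteFlatGroupSchemes, (3.7)] [cite: Liu2021, p. 137] -/
structure DockData (k : Type u) [Field k] (p f : ℕ) [ExpChar k p] (A : AbelianSchemeOver (Spec (.of k)))
    {O : Type v} [CommRing O] (act : RingAction O A) (w : Ideal O) where
  /-- K-DATA — the `w`-layer carrier `G₀ = A[w]`. [cite: Tate1997FiniteFlatGroupSchemes, (3.7)] -/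
  G₀ : SchemeOver k
  /-- its group-scheme structure. [cite: Tate1997FiniteFlatGroupSchemes, (3.7)] -/
  grp₀ : GrpObj G₀
  /-- commutative. [cite: Tate1997FiniteFlatGroupSchemes, (3.7)] -/
  comm₀ : IsCommMonObj G₀
  /-- affine. [cite: Tate1997FiniteFlatGroupSchemes, (3.7)] -/
  aff₀ : IsAffine G₀.left
  /-- finite over `k`. [cite: Tate1997FiniteFlatGroupSchemes, (3.7)] -/
  fin₀ : IsFinite G₀.hom
  /-- PIN — the closed immersion `ι₀G : G₀ ↪ A`. [cite: Tate1997FiniteFlatGroupSchemes, (3.7)] -/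
  ι₀G : G₀ ⟶ A.X
  /-- the `O`-action on `G₀`. [cite: Kottwitz1992, §5, p. 390] -/
  β₀ : O → (G₀ ⟶ G₀)
  /-- K-DATA — the unit component `U = G₀⁰`. [cite: Tate1997FiniteFlatGroupSchemes, (3.7)] -/
  U₀ : SchemeOver k
  /-- its group structure. [cite: Tate1997FiniteFlatGroupSchemes, (3.7)] -/
  grpU₀ : GrpObj U₀
  /-- affine. [cite: Tate1997FiniteFlatGroupSchemes, (3.7)] -/
  affU₀ : IsAffine U₀.left
  /-- the inclusion `jU : U → G₀`. [cite: Tate1997FiniteFlatGroupSchemes, (3.7)] -/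
  jU₀ : U₀ ⟶ G₀
  /-- the Frobenius height exponent of the unit component. [cite: Tate1997FiniteFlatGroupSchemes, (3.7)] -/
  NU₀ : ℕ
  /-- monogenic coordinate `k[X]∕(X^{p^{NU}}) ≃ Γ(U)`. [cite: Tate1997FiniteFlatGroupSchemes, (3.7)] -/
  θU₀ : (k[X] ⧸ Ideal.span {(X : k[X]) ^ (p ^ NU₀)}) ≃ₐ[k] Alg U₀
  /-- PIN — `ι₀G` is a homomorphism and a closed immersion. [cite: Tate1997FiniteFlatGroupSchemes, (3.7)] -/
  hι₀G : IsMonHom ι₀G ∧ IsClosedImmersion ι₀G.left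
  /-- PIN — `G₀ = A[w]` as the kernel of the ideal, on `T`-points. [cite: Tate1997FiniteFlatGroupSchemes, (3.7)] [cite: Liu2021, p. 137] -/
  hkerG₀ : ∀ ⦃T : SchemeOver k⦄ (t : T ⟶ A.X), (∀ r ∈ w, t ≫ act.i r = 1) ↔ ∃ s : T ⟶ G₀, s ≫ ι₀G = t
  /-- PIN — `β₀(c) ≫ ι₀G = ι₀G ≫ ι(c)`. [cite: Kottwitz1992, §5, p. 390] -/
  hβ₀G : ∀ c, β₀ c ≫ ι₀G = ι₀G ≫ act.i c
  /-- the action is by homomorphisms. [cite: Kottwitz1992, §5, p. 390] -/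
  hβ₀ : ∀ c, IsMonHom (β₀ c)
  /-- `jU` is a homomorphism, an open and closed immersion, with connected source. [cite: Tate1997FiniteFlatGroupSchemes, (3.7)] -/
  hU₀ : IsMonHom jU₀ ∧ IsOpenImmersion jU₀.left ∧ IsClosedImmersion jU₀.left ∧ ConnectedSpace ↥U₀.left
  /-- the height of the unit component is `f` or `2f`. [cite: Liu2021, p. 137] -/
  hNU₀ : NU₀ = f ∨ NU₀ = f + f
  /-- K-HYP — `F_{q²}` kills the unit component. [cite: Liu2021, p. 137] -/
  hFFU₀ : jU₀ ≫ relFrobeniusOver p f G₀ ≫ relFrobeniusOver p f (frobeniusTwistOver p f G₀) = 1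
  /-- K-HYP — rank `q²`. [cite: Liu2021, p. 137] [cite: RapoportSmithlingZhang2020Diagonal, §4.1 p. 17] -/
  hrkG₀ : Module.finrank k (Alg G₀) = p ^ f * p ^ f
  /-- K-HYP — rank `q` of the Frobenius quotient. [cite: Liu2021, p. 137] [cite: RapoportSmithlingZhang2020Diagonal, §4.1 p. 17] -/
  hrkF₀ : Module.finrank k (Alg G₀ ⧸ (RingHom.ker (kerι (relFrobeniusOver p f G₀)).left.appTop.hom : Ideal (Alg G₀))) = p ^ f
  /-- K-HYP — `#G₀(k) ∈ {1, q}`. [cite: Liu2021, p. 137] -/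
  hpts₀ : Nat.card (𝟙_ (SchemeOver k) ⟶ G₀) = 1 ∨ Nat.card (𝟙_ (SchemeOver k) ⟶ G₀) = p ^ f
  /-- K-HYP — the `O`-stable subgroups of `G₀(k)` are `⊥` and `⊤`. [cite: Liu2021, p. 137] -/
  hsimple₀ : ∀ Λ : Subgroup (𝟙_ (SchemeOver k) ⟶ G₀), (∀ c, ∀ x ∈ Λ, x ≫ β₀ c ∈ Λ) → Λ = ⊥ ∨ Λ = ⊤

set_option synthInstance.maxHeartbeats 100000 in
/-- **`DockPackage.nonempty_dockData`** — the package AS DATA (one `obtain` + the anonymous constructor; GEN heir (g31) Q2).  Sorry-free.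
[cite: Tate1997FiniteFlatGroupSchemes, (3.7)] [cite: Liu2021, p. 137] -/
theorem _root_.Summit.HodgeConjecture.HodgeConjecture.Cruxes.HLiu418.F0P6aRGDAssembly.DockPackage.nonempty_dockData
    {k : Type u} [Field k] {p f : ℕ} [ExpChar k p] {A : AbelianSchemeOver (Spec (.of k))}
    {O : Type v} [CommRing O] {act : RingAction O A} {w : Ideal O} (h : DockPackage k p f A act w) : Nonempty (DockData k p f A act w) := by
  obtain ⟨G₀, grp₀, comm₀, aff₀, fin₀, ι₀G, β₀, U₀, grpU₀, affU₀, jU₀, NU₀, θU₀, hι₀G, hkerG₀, hβ₀G, hβ₀, hU₀, hNU₀, hFFU₀, hrkG₀, hrkF₀, hpts₀,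
    hsimple₀⟩ := h
  exact ⟨{
    G₀ := G₀, grp₀ := grp₀, comm₀ := comm₀, aff₀ := aff₀, fin₀ := fin₀, ι₀G := ι₀G, β₀ := β₀, U₀ := U₀, grpU₀ := grpU₀, affU₀ := affU₀
    jU₀ := jU₀, NU₀ := NU₀, θU₀ := θU₀, hι₀G := hι₀G, hkerG₀ := hkerG₀, hβ₀G := hβ₀G, hβ₀ := hβ₀, hU₀ := hU₀, hNU₀ := hNU₀, hFFU₀ := hFFU₀
    hrkG₀ := hrkG₀, hrkF₀ := hrkF₀, hpts₀ := hpts₀, hsimple₀ := hsimple₀ }⟩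

end Dock

section Letters

variable {F : Type} [Field F] [NumberField F] [IsCMField F] {ι₁ : F →+* ℂ}
    {Jstar : Matrix (Fin 2) (Fin 2) F}
    {K₀ : C5.OpenCompactSubgroup ↥(finAdelic ↥(maximalRealSubfield F) F (IsCMField.complexConj F) 2 Jstar)}
    {S : RecordSystemGS F Jstar ι₁ K₀} {hU7ₛ : S.HeckeTranslateDefinedOver}
    {hJ : (Jstar.map (IsCMField.complexConj F))ᵀ = Jstar} {hJu : IsUnit Jstar}
    {Fi : Type} [Field Fi] [Algebra F Fi] {Kc : C5.SmallLevel K₀} {G : Type} [Group G]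
    {𝓜 : IntegralModel (𝓞 F) F ((thickening F Fi).obj (S.M.obj Kc))}
    {w : HeightOneSpectrum (𝓞 F)} {hw : (IsCMField.complexConj F) • w ≠ w} {h𝓨 : (𝓜.localise w).IsSmoothProper 1}
    {θ : ActionOver (𝓜.localise w).total.hom ((Fi ≃ₐ[F] Fi) × G)}
    {e : Fi →ₐ[F] AlgebraicClosure (w.adicCompletion F)}

/-- **`DockAt I x̄`** — THE DOCK AT THE SPECIAL POINT `x̄`: `DockData` read at `κ̄(w)`, `q = p^f`, the universal fibre `A_x̄ = (𝒜 ×_𝓨 𝓨_s) ×_{𝓨_s} x̄` with its action and the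
ideal `𝔭_{c•w}` — the ARGUMENTS of spine §4 `blockDock_of_inputs I x̄` token for token (`sch₀Of 𝓜 w I.univ x̄` UNFOLDED; `(act₀Of 𝓜 w I.univ I.act a x̄).hom.hom.hom` is
DEFINITIONALLY `((I.act.baseChange ι_s).baseChange x̄.left).i a`, P6d probe `probe-E4-seam-act0Of.v2.F0P6dplan-g3.lean` 3a05f216, `rfl`).  An abbreviation. [cite: Tate1997FiniteFlatGroupSchemes, (3.7)] -/
abbrev DockAt (I : RGDInputsAt F ι₁ Jstar K₀ S hU7ₛ hJ hJu Fi Kc G 𝓜 w hw h𝓨 θ e) [ExpChar (geomResidueField w) I.pChar]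
    (xbar : AlgPoints (𝓜.localise w).reductionAt (geomResidueField w)) : Type 1 :=
  DockData (geomResidueField w) I.pChar I.fDeg
    ((I.univ.baseChange (pullback.fst (𝓜.localise w).total.hom (specResidueField w))).baseChange xbar.left)
    ((I.act.baseChange (pullback.fst (𝓜.localise w).total.hom (specResidueField w))).baseChange xbar.left)
    ((IsCMField.complexConj F) • w).asIdeal

/-- **`nonempty_dockAt`** — spine §4 `blockDock_of_inputs` (= ★ P6d `blockDocking_of_line` with every input discharged) AS DATA at `x̄`.  Sorry-free.
[cite: Tate1997FiniteFlatGroupSchemes, (3.7)] [cite: Liu2021, p. 137] -/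
theorem nonempty_dockAt (I : RGDInputsAt F ι₁ Jstar K₀ S hU7ₛ hJ hJu Fi Kc G 𝓜 w hw h𝓨 θ e)
    (xbar : AlgPoints (𝓜.localise w).reductionAt (geomResidueField w)) :
    haveI : ExpChar (geomResidueField w) I.pChar := (haveI := I.charP₀; ExpChar.prime I.hpChar.1)
    Nonempty (DockAt I xbar) := by
  haveI : ExpChar (geomResidueField w) I.pChar := (haveI := I.charP₀; ExpChar.prime I.hpChar.1)
  exact (blockDock_of_inputs I xbar).nonempty_dockData

/-! ### §0b THE CARRIERS BY CONSTRUCTION (G5, fork F1 (a) ADM) -/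

/-- **D2-Ω `LineOf I y`** — THE LINES AT `y` ON THE SHEET `e`: the `𝒪_F`-stable subgroups of order `q = p^{f}` of `A_y(Ω)` killed by `𝔭_{c•w}` — EXACTLY the codomain of the
(L4) bijection `β ↦ H_β` (`HeckeRoofsΩ`, admissibility clause verbatim at `e′ := e`).  Presentation-free (the `hecke` law quantifies over all `(N′, rc₁, rc₂, x′)`).
[cite: HarrisTaylorAMS2001, §III.4, pp. 108–110] [cite: Liu2021, Prop. D.8 p. 135] -/
def LineOf (I : RGDInputsAt F ι₁ Jstar K₀ S hU7ₛ hJ hJu Fi Kc G 𝓜 w hw h𝓨 θ e)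
    (y : AlgPoints (S.M.obj Kc) (AlgebraicClosure (w.adicCompletion F))) : Type :=
  {H : Subgroup ((fibreΩOf S Kc 𝓜 w e I.univ y).Points (AlgebraicClosure (w.adicCompletion F))) //
    Nat.card ↥H = I.pChar ^ I.fDeg ∧
    (∀ P ∈ H, IsIdealTorsionΩ S Kc 𝓜 w e I.univ I.act y ((IsCMField.complexConj F) • w).asIdeal P) ∧
    ∀ (a : 𝓞 F), ∀ P ∈ H, (AlgPoints.map (actΩOf S Kc 𝓜 w e I.univ I.act a y).hom.hom.hom P :
      (fibreΩOf S Kc 𝓜 w e I.univ y).Points (AlgebraicClosure (w.adicCompletion F))) ∈ H}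

variable (I : RGDInputsAt F ι₁ Jstar K₀ S hU7ₛ hJ hJu Fi Kc G 𝓜 w hw h𝓨 θ e) [ExpChar (geomResidueField w) I.pChar]

/-- **D2-κ̄ `SubOf I 𝔡 x̄ := AdmSub (G₀ x̄) (β₀ x̄) q`** (★ P6c §1) — so `subEquiv := Equiv.refl`. [cite: Tate1997FiniteFlatGroupSchemes, (3.7)] -/
def SubOf (𝔡 : ∀ xbar, DockAt I xbar) (xbar : AlgPoints (𝓜.localise w).reductionAt (geomResidueField w)) : Type :=
  letI := (𝔡 xbar).grp₀; haveI := (𝔡 xbar).aff₀; AdmSub (𝔡 xbar).G₀ (𝔡 xbar).β₀ (I.pChar ^ I.fDeg)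

/-- **D3 `kerFOf I 𝔡 x̄ := ⟨kerFI p f (G₀ x̄), isAdm_kerFI …⟩`** (★ P6c K0 `isAdm_kerFI` from the dock rows `hβ₀`, `hrkF₀`) — so `kerF_spec := rfl`. [cite: SGA3I, VII_A 4.1] -/
def kerFOf (𝔡 : ∀ xbar, DockAt I xbar) (xbar : AlgPoints (𝓜.localise w).reductionAt (geomResidueField w)) : SubOf I 𝔡 xbar :=
  letI := (𝔡 xbar).grp₀; haveI := (𝔡 xbar).aff₀
  ⟨kerFI I.pChar I.fDeg (𝔡 xbar).G₀, isAdm_kerFI I.pChar I.fDeg (𝔡 xbar).G₀ (𝔡 xbar).β₀ (𝔡 xbar).hβ₀ (𝔡 xbar).hrkF₀⟩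

/-- **D3 `IsEtaleOf I 𝔡 H := IdealIsEtale (G₀ x̄) H.1`** (★ P6c §1) — so `isEtale_spec := Iff.rfl`. [cite: Tate1997FiniteFlatGroupSchemes, (3.7)] -/
def IsEtaleOf (𝔡 : ∀ xbar, DockAt I xbar) {xbar : AlgPoints (𝓜.localise w).reductionAt (geomResidueField w)} (H : SubOf I 𝔡 xbar) : Prop :=
  letI := (𝔡 xbar).grp₀; haveI := (𝔡 xbar).aff₀; IdealIsEtale (𝔡 xbar).G₀ H.1

/-! ### §0c LETTERS: the Hecke clause, the roof links, the downstairs readings interface -/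

omit [ExpChar (geomResidueField w) I.pChar] in
/-- **`HeckeClause I quotΩ translΩ`** — the `ModuliDatum.hecke` field type (Defs ED. 3 :837–:877) VERBATIM over `Line := LineOf I` and the readings `quotΩ`, `translΩ`.
A definition; NOTHING is asserted by declaring it. [cite: Liu2021, Prop. D.8 (1)(2) p. 135] [cite: HarrisTaylorAMS2001, §III.4, pp. 108–110] -/
def HeckeClause (quotΩ : ∀ y, LineOf I y → AlgPoints (S.M.obj Kc) (AlgebraicClosure (w.adicCompletion F)))
    (translΩ : AlgPoints (S.M.obj Kc) (AlgebraicClosure (w.adicCompletion F)) → AlgPoints (S.M.obj Kc) (AlgebraicClosure (w.adicCompletion F))) :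
    Prop :=
  ∀ (N' : C5.SmallLevel K₀) (hN'Kc : N' ≤ Kc)
    (rc₁ : orbit (Kc.1.1 : Subgroup ↥(finAdelic ↥(maximalRealSubfield F) F (IsCMField.complexConj F) 2 Jstar))
         ((UnitaryGroup.heckeElementAt ↥(maximalRealSubfield F) F (IsCMField.complexConj F) 2 Jstar
             (⟨w, rfl⟩ : UnitaryGroup.PlacesOver F (w.under (𝓞 ↥(maximalRealSubfield F))))
             (IsCMField.complexConj_ne_one F) hJ hw (UnitaryGroup.isUnit_placeForm Jstar hJu w) (HeckeCharacter.uniformizer F w) 1 :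
           ↥(finAdelic ↥(maximalRealSubfield F) F (IsCMField.complexConj F) 2 Jstar)) :
           ↥(finAdelic ↥(maximalRealSubfield F) F (IsCMField.complexConj F) 2 Jstar) ⧸
             (Kc.1.1 : Subgroup ↥(finAdelic ↥(maximalRealSubfield F) F (IsCMField.complexConj F) 2 Jstar))) →
       ↥(finAdelic ↥(maximalRealSubfield F) F (IsCMField.complexConj F) 2 Jstar)),
    (∀ β, ((rc₁ β : ↥(finAdelic ↥(maximalRealSubfield F) F (IsCMField.complexConj F) 2 Jstar)) :
        ↥(finAdelic ↥(maximalRealSubfield F) F (IsCMField.complexConj F) 2 Jstar) ⧸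
          (Kc.1.1 : Subgroup ↥(finAdelic ↥(maximalRealSubfield F) F (IsCMField.complexConj F) 2 Jstar))) = β.1) →
    ∀ (hrcN₁ : ∀ β, C5.HeckeLE (rc₁ β) N' Kc)
      (rc₂ : orbit (Kc.1.1 : Subgroup ↥(finAdelic ↥(maximalRealSubfield F) F (IsCMField.complexConj F) 2 Jstar))
         ((UnitaryGroup.heckeElementAt ↥(maximalRealSubfield F) F (IsCMField.complexConj F) 2 Jstar
             (⟨w, rfl⟩ : UnitaryGroup.PlacesOver F (w.under (𝓞 ↥(maximalRealSubfield F))))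
             (IsCMField.complexConj_ne_one F) hJ hw (UnitaryGroup.isUnit_placeForm Jstar hJu w) (HeckeCharacter.uniformizer F w) 2 :
           ↥(finAdelic ↥(maximalRealSubfield F) F (IsCMField.complexConj F) 2 Jstar)) :
           ↥(finAdelic ↥(maximalRealSubfield F) F (IsCMField.complexConj F) 2 Jstar) ⧸
             (Kc.1.1 : Subgroup ↥(finAdelic ↥(maximalRealSubfield F) F (IsCMField.complexConj F) 2 Jstar))) →
       ↥(finAdelic ↥(maximalRealSubfield F) F (IsCMField.complexConj F) 2 Jstar)),
    (∀ β, ((rc₂ β : ↥(finAdelic ↥(maximalRealSubfield F) F (IsCMField.complexConj F) 2 Jstar)) :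
        ↥(finAdelic ↥(maximalRealSubfield F) F (IsCMField.complexConj F) 2 Jstar) ⧸
          (Kc.1.1 : Subgroup ↥(finAdelic ↥(maximalRealSubfield F) F (IsCMField.complexConj F) 2 Jstar))) = β.1) →
    ∀ (hrcN₂ : ∀ β, C5.HeckeLE (rc₂ β) N' Kc),
    ∀ x' : AlgPoints (S.M.obj N') (AlgebraicClosure (w.adicCompletion F)),
      ∃ e : (orbit (Kc.1.1 : Subgroup ↥(finAdelic ↥(maximalRealSubfield F) F (IsCMField.complexConj F) 2 Jstar))
         ((UnitaryGroup.heckeElementAt ↥(maximalRealSubfield F) F (IsCMField.complexConj F) 2 Jstar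
             (⟨w, rfl⟩ : UnitaryGroup.PlacesOver F (w.under (𝓞 ↥(maximalRealSubfield F))))
             (IsCMField.complexConj_ne_one F) hJ hw (UnitaryGroup.isUnit_placeForm Jstar hJu w) (HeckeCharacter.uniformizer F w) 1 :
           ↥(finAdelic ↥(maximalRealSubfield F) F (IsCMField.complexConj F) 2 Jstar)) :
           ↥(finAdelic ↥(maximalRealSubfield F) F (IsCMField.complexConj F) 2 Jstar) ⧸
             (Kc.1.1 : Subgroup ↥(finAdelic ↥(maximalRealSubfield F) F (IsCMField.complexConj F) 2 Jstar)))) ≃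
          LineOf I (AlgPoints.map (S.M.map (homOfLE hN'Kc)) x'),
        (∀ β, AlgPoints.map (recordHeckeTranslateGS S hU7ₛ (rc₁ β) N' Kc (hrcN₁ β)) x' =
            quotΩ (AlgPoints.map (S.M.map (homOfLE hN'Kc)) x') (e β)) ∧
        ∀ β₂, AlgPoints.map (recordHeckeTranslateGS S hU7ₛ (rc₂ β₂) N' Kc (hrcN₂ β₂)) x' =
            translΩ (AlgPoints.map (S.M.map (homOfLE hN'Kc)) x')

omit [ExpChar (geomResidueField w) I.pChar] in
set_option maxHeartbeats 400000 in
/-- **`RoofLink I quotΩ`** — the reading `quotΩ y L` IS A ROOF NEIGHBOUR OF `y` THROUGH A KERNEL MEETING THE `𝔭_{c•w}`-TORSION IN `L` (helper `RoofΩ`, the (L4) roof clause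
as a property of the reading; with (L1) `injΩ` it PINS `quotΩ`).  A definition. [cite: Liu2021, Prop. D.8 p. 135] [cite: HarrisTaylorAMS2001, §III.4, pp. 108–110] -/
def RoofLink (quotΩ : ∀ y, LineOf I y → AlgPoints (S.M.obj Kc) (AlgebraicClosure (w.adicCompletion F))) : Prop :=
  ∀ (y : AlgPoints (S.M.obj Kc) (AlgebraicClosure (w.adicCompletion F))) (L : LineOf I y),
    ∃ K : Subgroup ((fibreΩOf S Kc 𝓜 w e I.univ y).Points (AlgebraicClosure (w.adicCompletion F))),
      (∀ P, P ∈ L.1 ↔ P ∈ K ∧ IsIdealTorsionΩ S Kc 𝓜 w e I.univ I.act y ((IsCMField.complexConj F) • w).asIdeal P) ∧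
      RoofΩ S Kc 𝓜 w e I.univ I.act I.dual I.pol I.lvl I.pChar w.asIdeal y (quotΩ y L) K

omit [ExpChar (geomResidueField w) I.pChar] in
set_option maxHeartbeats 400000 in
/-- **`RoofLink₂ I translΩ`** — the reading `translΩ y` is the roof neighbour of `y` through the WHOLE `𝔭_{c•w}`-torsion (the central translate `⟨ϖ⟩`; (L4) last clause).
A definition. [cite: Liu2021, Prop. D.8 p. 135] -/
def RoofLink₂ (translΩ : AlgPoints (S.M.obj Kc) (AlgebraicClosure (w.adicCompletion F)) → AlgPoints (S.M.obj Kc) (AlgebraicClosure (w.adicCompletion F))) :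
    Prop :=
  ∀ (y : AlgPoints (S.M.obj Kc) (AlgebraicClosure (w.adicCompletion F))),
    ∃ K₂ : Subgroup ((fibreΩOf S Kc 𝓜 w e I.univ y).Points (AlgebraicClosure (w.adicCompletion F))),
      (∀ P, P ∈ K₂ ↔ IsIdealTorsionΩ S Kc 𝓜 w e I.univ I.act y ((IsCMField.complexConj F) • w).asIdeal P) ∧
      RoofΩ S Kc 𝓜 w e I.univ I.act I.dual I.pol I.lvl I.pChar w.asIdeal y (translΩ y) K₂


end Letters

end Summit.HodgeConjecture.HodgeConjecture.Cruxes.HLiu418.F0P6aDatumOfInputs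

end
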